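import Summits.NavierStokesRegularity.TurbBounds.LayerForm
import Summits.NavierStokesRegularity.TurbBounds.TailSeqGenW
import Summits.NavierStokesRegularity.TurbBounds.CouplingSplit
import HarnessLib

/-!
# Tail lemma, generic `(N, P)` and generic weights `(A, B)` — the RB-type form `rbForm A B g K` and its lower bound on POLYNOMIAL test fields
(cell `pub-turb` / `turb-bounds`; v2 groundwork for the RB rows (rbsdp SPEC 3.3: velocity weight `A = (s−1)/Ra`, temperature weight `B = s`,
coupling profile `g`); `LayerForm.layerForm s κ η′ K = rbForm (s − 1) s (gOf s κ η′) K` (`layerForm_eq_rbForm`). Same proof as `TailPolyGen`.)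

HONEST FRAMING: rigorous bounds for the stated PDE and boundary conditions; no claim about physical turbulence beyond the bound.
`rbForm_poly_lower_bound`: for weights `A, B ≥ 0`, a polynomial coupling profile `gp` of degree `≤ P` with `|g| ≤ T` on `[-1,1]`,
`K > 0`, `ε > 0`, and polynomial test fields with `W(-1) = W'(-1) = Θ(-1) = 0` (nothing is assumed at `+1`):
`finGenW + (16A/K − Tε·lam(N+P)·lam(N+P+1))·‖tail of W'' from N+P+3‖² + (4B − T·lam(N+P)/ε)·‖tail of Θ' from N+P+2‖² ≤ rbForm`,
where `finGenW` is the explicit tracked finite part in the Legendre coefficients `c, a, b, d, e` of `W'', W', W, Θ', Θ`.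
-/

set_option linter.style.longLine false

noncomputable section

namespace Summit.NavierStokesRegularity.TurbBounds.TailPolyGenW

open Polynomial intervalIntegral MeasureTheory Finset Set
open Summit.NavierStokesRegularity.TurbBounds.LayerForm
open Summit.NavierStokesRegularity.TurbBounds.LadderTail (w IsLadder phi lam w_pos)
open Summit.NavierStokesRegularity.TurbBounds.LegendreCoeffs
open Summit.NavierStokesRegularity.TurbBounds.LegendreTails
open Summit.NavierStokesRegularity.TurbBounds.CouplingSplit
open Summit.NavierStokesRegularity.TurbBounds.TailSeqGenW

/-- Integrand of the RB-type quadratic form at wavenumber datum `K`: `A(16W″²/K + 8W′² + KW²) + B(4Θ′² + KΘ²) + 2 g W Θ` at `x`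
(rbsdp SPEC 3.3 in the layer variable `x ∈ [-1, 1]`; the mode matrix rule is its Legendre–Galerkin form). -/
def rbIntegrand (A B : ℝ) (g : ℝ → ℝ) (K : ℝ) (W Θ : ℝ → ℝ) (x : ℝ) : ℝ :=
  A * (16 * (deriv (deriv W) x) ^ 2 / K + 8 * (deriv W x) ^ 2 + K * (W x) ^ 2) + B * (4 * (deriv Θ x) ^ 2 + K * (Θ x) ^ 2)
    + 2 * g x * W x * Θ x

/-- The RB-type form `∫_{-1}^{1} rbIntegrand`. -/
def rbForm (A B : ℝ) (g : ℝ → ℝ) (K : ℝ) (W Θ : ℝ → ℝ) : ℝ :=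
  ∫ x in (-1 : ℝ)..1, rbIntegrand A B g K W Θ x

/-- The P2 layer form is the RB-type form with weights `(s − 1, s)` and profile `gOf s κ η′`. -/
theorem layerForm_eq_rbForm (s κ : ℝ) (ηp : ℝ → ℝ) (K : ℝ) (V Θ : ℝ → ℝ) :
    layerForm s κ ηp K V Θ = rbForm (s - 1) s (gOf s κ ηp) K V Θ := by
  unfold layerForm rbForm
  refine intervalIntegral.integral_congr fun x _ => ?_
  simp only [layerIntegrand, rbIntegrand]

/-- The tracked finite part for truncation `(N, P)` and weights `(A, B)`: Parseval pieces of the tracked coefficients, twice the exact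
coupling over the index set `S`, minus the Young/tail corrections of SPEC 3.6 (`GW0 + HW`, `GT0 + HT` in sequence form). -/
def finGenW (N P : ℕ) (A B u v ε T : ℝ) (ĝ c a b d e : ℕ → ℝ) : ℝ :=
  A * (16 * u * ∑ n ∈ range (N + P + 3), w n * c n ^ 2 + 8 * ∑ n ∈ range (N + P + 2), w n * a n ^ 2
        + v * ∑ n ∈ range (N + P + 1), w n * b n ^ 2)
    + B * (4 * ∑ n ∈ range (N + P + 2), w n * d n ^ 2 + v * ∑ n ∈ range (N + P + 1), w n * e n ^ 2)
    + 2 * couplingExact N P ĝ b e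
    - T * ε * (∑ k ∈ range P, w (N + 1 + k) * b (N + 1 + k) ^ 2 + phi (N + P) * a (N + P) ^ 2 + phi (N + P + 1) * a (N + P + 1) ^ 2
        + lam (N + P) * (phi (N + P + 1) * c (N + P + 1) ^ 2 + phi (N + P + 2) * c (N + P + 2) ^ 2))
    - T / ε * (∑ k ∈ range P, w (N + 1 + k) * e (N + 1 + k) ^ 2 + phi (N + P) * d (N + P) ^ 2 + phi (N + P + 1) * d (N + P + 1) ^ 2)

/-- integral over `[-1, 1]` of a six-term combination of continuous functions -/
private theorem integral_comb6 {f1 f2 f3 f4 f5 f6 : ℝ → ℝ} (h1 : Continuous f1) (h2 : Continuous f2) (h3 : Continuous f3)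
    (h4 : Continuous f4) (h5 : Continuous f5) (h6 : Continuous f6) (c1 c2 c3 c4 c5 c6 : ℝ) :
    ∫ x in (-1 : ℝ)..1, (c1 * f1 x + c2 * f2 x + c3 * f3 x + c4 * f4 x + c5 * f5 x + c6 * f6 x)
      = c1 * (∫ x in (-1 : ℝ)..1, f1 x) + c2 * (∫ x in (-1 : ℝ)..1, f2 x) + c3 * (∫ x in (-1 : ℝ)..1, f3 x)
        + c4 * (∫ x in (-1 : ℝ)..1, f4 x) + c5 * (∫ x in (-1 : ℝ)..1, f5 x) + c6 * (∫ x in (-1 : ℝ)..1, f6 x) := by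
  have I : ∀ {g : ℝ → ℝ}, Continuous g → IntervalIntegrable g volume (-1 : ℝ) 1 := fun hg => hg.intervalIntegrable _ _
  rw [integral_add (I (by fun_prop)) (I (by fun_prop)), integral_add (I (by fun_prop)) (I (by fun_prop)),
    integral_add (I (by fun_prop)) (I (by fun_prop)), integral_add (I (by fun_prop)) (I (by fun_prop)),
    integral_add (I (by fun_prop)) (I (by fun_prop))]
  simp only [intervalIntegral.integral_const_mul]

/-- The RB-type form on polynomial test fields with a polynomial coupling profile, as six polynomial integrals. -/
theorem rbForm_poly_eq_gen {A B K : ℝ} {g : ℝ → ℝ} (gp : ℝ[X]) (hg : ∀ x, g x = gp.eval x) (Vp Θp : ℝ[X]) :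
    rbForm A B g K (fun x => Vp.eval x) (fun x => Θp.eval x)
      = A * (16 / K) * (∫ x in (-1 : ℝ)..1, (derivative (derivative Vp)).eval x ^ 2)
        + A * 8 * (∫ x in (-1 : ℝ)..1, (derivative Vp).eval x ^ 2)
        + A * K * (∫ x in (-1 : ℝ)..1, Vp.eval x ^ 2) + B * 4 * (∫ x in (-1 : ℝ)..1, (derivative Θp).eval x ^ 2)
        + B * K * (∫ x in (-1 : ℝ)..1, Θp.eval x ^ 2)
        + 2 * (∫ x in (-1 : ℝ)..1, gp.eval x * Vp.eval x * Θp.eval x) := by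
  have hdV : deriv (fun x => Vp.eval x) = fun x => (derivative Vp).eval x := by
    funext x; exact Polynomial.deriv Vp
  have hdV1 : deriv (fun x => (derivative Vp).eval x) = fun x => (derivative (derivative Vp)).eval x := by
    funext x; exact Polynomial.deriv (derivative Vp)
  have hdΘ : deriv (fun x => Θp.eval x) = fun x => (derivative Θp).eval x := by
    funext x; exact Polynomial.deriv Θp
  unfold rbForm
  rw [← integral_comb6 (by fun_prop) (by fun_prop) (by fun_prop) (by fun_prop) (by fun_prop) (by fun_prop)]
  refine intervalIntegral.integral_congr fun x _ => ?_
  simp only [rbIntegrand, hg, hdV, hdV1, hdΘ]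
  ring

/-- Tail-window bookkeeping: `Σ_{n < N+1+(P+M)} [n > N]·f n = Σ_{k<P} f (N+1+k) + Σ_{k<M} f (N+P+1+k)`. -/
private theorem sum_tail_split (N P M : ℕ) (f : ℕ → ℝ) :
    ∑ n ∈ range (N + 1 + (P + M)), (if n ≤ N then 0 else f n)
      = ∑ k ∈ range P, f (N + 1 + k) + ∑ k ∈ range M, f (N + P + 1 + k) := by
  rw [sum_range_add]
  have h0 : ∑ n ∈ range (N + 1), (if n ≤ N then 0 else f n) = 0 :=
    sum_eq_zero fun n hn => by rw [Finset.mem_range] at hn; rw [if_pos (by omega)]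
  rw [h0, zero_add, sum_range_add]
  congr 1
  · exact sum_congr rfl fun k _ => by rw [if_neg (by omega)]
  · exact sum_congr rfl fun k _ => by rw [if_neg (by omega), show N + 1 + (P + k) = N + P + 1 + k by ring]

/-- **Generic `(N, P)`, generic-weight lower bound of the RB-type form on polynomial test fields by the tracked finite part.** -/
theorem rbForm_poly_lower_bound (N P : ℕ) {A B K T ε : ℝ} {g : ℝ → ℝ} (gp : ℝ[X]) (hgdeg : gp.natDegree ≤ P)
    (hg : ∀ x, g x = gp.eval x) (hT : ∀ x ∈ Icc (-1 : ℝ) 1, |gp.eval x| ≤ T) (hA0 : 0 ≤ A) (hB0 : 0 ≤ B) (hK : 0 < K) (hε : 0 < ε)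
    (Vp Θp : ℝ[X]) (hV0 : Vp.eval (-1) = 0) (hV1 : (derivative Vp).eval (-1) = 0) (hΘ0 : Θp.eval (-1) = 0) :
    finGenW N P A B (1 / K) K ε T (legCoeff gp) (legCoeff (derivative (derivative Vp))) (legCoeff (derivative Vp)) (legCoeff Vp)
        (legCoeff (derivative Θp)) (legCoeff Θp)
      + (16 * (1 / K) * A - T * ε * (lam (N + P) * lam (N + P + 1)))
          * ∑ k ∈ range (max Vp.natDegree Θp.natDegree + 2),
              w (N + P + 3 + k) * legCoeff (derivative (derivative Vp)) (N + P + 3 + k) ^ 2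
      + (4 * B - T * lam (N + P) / ε)
          * ∑ k ∈ range (max Vp.natDegree Θp.natDegree + 2), w (N + P + 2 + k) * legCoeff (derivative Θp) (N + P + 2 + k) ^ 2
      ≤ rbForm A B g K (fun x => Vp.eval x) (fun x => Θp.eval x) := by
  set c := legCoeff (derivative (derivative Vp)) with hcdef
  set a := legCoeff (derivative Vp) with hadef
  set b := legCoeff Vp with hbdef
  set d := legCoeff (derivative Θp) with hddef
  set e := legCoeff Θp with hedef
  set L := max Vp.natDegree Θp.natDegree with hL
  have hform := rbForm_poly_eq_gen gp hg Vp Θp (A := A) (B := B) (K := K)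
  set V1 := derivative Vp with hV1def
  set V2 := derivative V1 with hV2def
  set Θ1 := derivative Θp with hΘ1def
  have hdegV : Vp.natDegree ≤ L := le_max_left _ _
  have hdegΘ : Θp.natDegree ≤ L := le_max_right _ _
  have hdegV1 : V1.natDegree ≤ L := by rw [hV1def]; exact (natDegree_derivative_le Vp).trans (by omega)
  have hdegV2 : V2.natDegree ≤ L := by rw [hV2def]; exact (natDegree_derivative_le V1).trans (by omega)
  have hdegΘ1 : Θ1.natDegree ≤ L := by rw [hΘ1def]; exact (natDegree_derivative_le Θp).trans (by omega)
  -- Parseval with the generic split points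
  have hPc : ∫ x in (-1 : ℝ)..1, V2.eval x ^ 2
      = ∑ n ∈ range (N + P + 3), w n * c n ^ 2 + ∑ k ∈ range (L + 2), w (N + P + 3 + k) * c (N + P + 3 + k) ^ 2 := by
    rw [integral_sq_eq_sum_of_lt V2 (R := N + P + 3 + (L + 2)) (by omega), sum_range_add]
  have hPa : ∫ x in (-1 : ℝ)..1, V1.eval x ^ 2
      = ∑ n ∈ range (N + P + 2), w n * a n ^ 2 + ∑ k ∈ range (L + 2), w (N + P + 2 + k) * a (N + P + 2 + k) ^ 2 := by
    rw [integral_sq_eq_sum_of_lt V1 (R := N + P + 2 + (L + 2)) (by omega), sum_range_add]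
  have hPb : ∫ x in (-1 : ℝ)..1, Vp.eval x ^ 2
      = ∑ n ∈ range (N + P + 1), w n * b n ^ 2 + ∑ k ∈ range (L + 2), w (N + P + 1 + k) * b (N + P + 1 + k) ^ 2 := by
    rw [integral_sq_eq_sum_of_lt Vp (R := N + P + 1 + (L + 2)) (by omega), sum_range_add]
  have hPd : ∫ x in (-1 : ℝ)..1, Θ1.eval x ^ 2
      = ∑ n ∈ range (N + P + 2), w n * d n ^ 2 + ∑ k ∈ range (L + 2), w (N + P + 2 + k) * d (N + P + 2 + k) ^ 2 := by
    rw [integral_sq_eq_sum_of_lt Θ1 (R := N + P + 2 + (L + 2)) (by omega), sum_range_add]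
  have hPe : ∫ x in (-1 : ℝ)..1, Θp.eval x ^ 2
      = ∑ n ∈ range (N + P + 1), w n * e n ^ 2 + ∑ k ∈ range (L + 2), w (N + P + 1 + k) * e (N + P + 1 + k) ^ 2 := by
    rw [integral_sq_eq_sum_of_lt Θp (R := N + P + 1 + (L + 2)) (by omega), sum_range_add]
  -- coupling: exact part + remainder, remainder bounded
  have hcs := coupling_split N P gp Vp Θp hgdeg
  set Rc2 := 2 * ∫ x in (-1 : ℝ)..1, gp.eval x * (legTail N Vp).eval x * (legTail N Θp).eval x with hRc2
  have htailV : ∫ x in (-1 : ℝ)..1, (legTail N Vp).eval x ^ 2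
      = ∑ k ∈ range P, w (N + 1 + k) * b (N + 1 + k) ^ 2 + ∑ k ∈ range (L + 2), w (N + P + 1 + k) * b (N + P + 1 + k) ^ 2 := by
    rw [integral_legTail_sq N Vp (R := N + 1 + (P + (L + 2))) (by omega) (by omega)]
    exact sum_tail_split N P (L + 2) (fun n => w n * b n ^ 2)
  have htailΘ : ∫ x in (-1 : ℝ)..1, (legTail N Θp).eval x ^ 2
      = ∑ k ∈ range P, w (N + 1 + k) * e (N + 1 + k) ^ 2 + ∑ k ∈ range (L + 2), w (N + P + 1 + k) * e (N + P + 1 + k) ^ 2 := by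
    rw [integral_legTail_sq N Θp (R := N + 1 + (P + (L + 2))) (by omega) (by omega)]
    exact sum_tail_split N P (L + 2) (fun n => w n * e n ^ 2)
  have hT0 : 0 ≤ T := le_trans (abs_nonneg _) (hT (-1) ⟨le_rfl, by norm_num⟩)
  have hR : |Rc2| ≤ T * (ε * (∑ k ∈ range P, w (N + 1 + k) * b (N + 1 + k) ^ 2 + ∑ k ∈ range (L + 2), w (N + P + 1 + k) * b (N + P + 1 + k) ^ 2)
      + ε⁻¹ * (∑ k ∈ range P, w (N + 1 + k) * e (N + 1 + k) ^ 2 + ∑ k ∈ range (L + 2), w (N + P + 1 + k) * e (N + P + 1 + k) ^ 2)) := by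
    rw [← htailV, ← htailΘ, hRc2]
    exact coupling_tail_bound gp.continuous (legTail N Vp).continuous (legTail N Θp).continuous hT hε
  -- ladders
  have hA : IsLadder c a := isLadder_legCoeff V1 hV1
  have hB : IsLadder a b := isLadder_legCoeff Vp hV0
  have hE : IsLadder d e := isLadder_legCoeff Θp hΘ0
  -- the sequence-level split
  have hsplit := seq_split_genW N P L hA hB hE hA0 hB0 hK.le hε hT0 hR (u := 1 / K) (X := couplingExact N P (legCoeff gp) b e)
  -- the layer form IS the Parseval form
  have hlayer : rbForm A B g K (fun x => Vp.eval x) (fun x => Θp.eval x)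
      = A * (16 * (1 / K) * (∑ n ∈ range (N + P + 3), w n * c n ^ 2 + ∑ k ∈ range (L + 2), w (N + P + 3 + k) * c (N + P + 3 + k) ^ 2)
            + 8 * (∑ n ∈ range (N + P + 2), w n * a n ^ 2 + ∑ k ∈ range (L + 2), w (N + P + 2 + k) * a (N + P + 2 + k) ^ 2)
            + K * (∑ n ∈ range (N + P + 1), w n * b n ^ 2 + ∑ k ∈ range (L + 2), w (N + P + 1 + k) * b (N + P + 1 + k) ^ 2))
        + B * (4 * (∑ n ∈ range (N + P + 2), w n * d n ^ 2 + ∑ k ∈ range (L + 2), w (N + P + 2 + k) * d (N + P + 2 + k) ^ 2)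
            + K * (∑ n ∈ range (N + P + 1), w n * e n ^ 2 + ∑ k ∈ range (L + 2), w (N + P + 1 + k) * e (N + P + 1 + k) ^ 2))
        + 2 * couplingExact N P (legCoeff gp) b e + Rc2 := by
    rw [hform, hPc, hPa, hPb, hPd, hPe, hcs, hRc2]
    have hK0 : K ≠ 0 := hK.ne'
    field_simp
    ring
  rw [hlayer]
  unfold finGenW
  linarith [hsplit]

end Summit.NavierStokesRegularity.TurbBounds.TailPolyGenW

end
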